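import HarnessLib
import Summits.RiemannHypothesis.RiemannHypothesis.Theorems.SignConePointwiseCertThreeHalvesTail
import Summits.RiemannHypothesis.RiemannHypothesis.Theorems.SignConePointwiseCertThreeHalvesGroups0
import Summits.RiemannHypothesis.RiemannHypothesis.Theorems.SignConePointwiseCertThreeHalvesGroups1
import Summits.RiemannHypothesis.RiemannHypothesis.Theorems.SignConePointwiseCertThreeHalvesGroups2
import Summits.RiemannHypothesis.RiemannHypothesis.Theorems.SignConePointwiseCertThreeHalvesGroups3
import Summits.RiemannHypothesis.RiemannHypothesis.Theorems.SignConePointwiseCertThreeHalvesGroups4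
import Summits.RiemannHypothesis.RiemannHypothesis.Theorems.SignConePointwiseCertThreeHalvesGroups5
import Summits.RiemannHypothesis.RiemannHypothesis.Theorems.SignConePointwiseCertThreeHalvesGroups6
import Summits.RiemannHypothesis.RiemannHypothesis.Theorems.SignConePointwiseCertThreeHalvesGroups7
import Summits.RiemannHypothesis.RiemannHypothesis.Theorems.SignConePointwiseCertThreeHalvesGroups8
import Summits.RiemannHypothesis.RiemannHypothesis.Theorems.SignConePointwiseCertThreeHalvesGroups9
import Summits.RiemannHypothesis.RiemannHypothesis.Theorems.SignConePointwiseCertThreeHalvesGroups10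
import Summits.RiemannHypothesis.RiemannHypothesis.Theorems.SignConePointwiseCertThreeHalvesGroups11
import Summits.RiemannHypothesis.RiemannHypothesis.Theorems.SignConePointwiseCertThreeHalvesGroups12
import Summits.RiemannHypothesis.RiemannHypothesis.Theorems.SignConePointwiseCertThreeHalvesGroups13
import Summits.RiemannHypothesis.RiemannHypothesis.Theorems.SignConePointwiseCertThreeHalvesGroups14
import Summits.RiemannHypothesis.RiemannHypothesis.Theorems.SignConePointwiseCertThreeHalvesGroups15
import Summits.RiemannHypothesis.RiemannHypothesis.Theorems.SignConePointwiseCertThreeHalvesGroups16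
import Summits.RiemannHypothesis.RiemannHypothesis.Theorems.SignConePointwiseCertThreeHalvesGroups17
import Summits.RiemannHypothesis.RiemannHypothesis.Theorems.SignConePointwiseCertThreeHalvesGroups18
import Summits.RiemannHypothesis.RiemannHypothesis.Theorems.SignConePointwiseCertThreeHalvesGroups19
import Summits.RiemannHypothesis.RiemannHypothesis.Theorems.SignConePointwiseCertThreeHalvesGroups20
import Summits.RiemannHypothesis.RiemannHypothesis.Theorems.SignConePointwiseCertThreeHalvesGroups21
import Summits.RiemannHypothesis.RiemannHypothesis.Theorems.SignConePointwiseCertThreeHalvesGroups22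
import Summits.RiemannHypothesis.RiemannHypothesis.Theorems.SignConePointwiseCertThreeHalvesGroups23
import Summits.RiemannHypothesis.RiemannHypothesis.Theorems.SignConePointwiseCertThreeHalvesGroups24
import Summits.RiemannHypothesis.RiemannHypothesis.Theorems.SignConePointwiseCertThreeHalvesGroups25
import Summits.RiemannHypothesis.RiemannHypothesis.Theorems.SignConePointwiseCertThreeHalvesGroups26
import Summits.RiemannHypothesis.RiemannHypothesis.Theorems.SignConePointwiseCertThreeHalvesGroups27
import Summits.RiemannHypothesis.RiemannHypothesis.Theorems.SignConePointwiseCertThreeHalvesGroups28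

/-!
# Route SignCone: pointwise certificate `pwCert32` — assembly: the density is non-negative

Support for the unconditional rungs of `SignConeOscillatory` / `SignConeInequality`
(items stmt-RiemannHypothesis-16302 / 16301). The anchored grid groups of `SignConePointwiseCertThreeHalvesGroups*.lean`
chain from `0` to `Y₀ = 425` (`pwCert32_chain`), so by `PWData.F_add_Hsos_nonneg_of_checksZ` (corrected
fast checker, `SignConePointwiseCheckerZSound.lean`) the CORRECTED density of the certificate `pwCert32`
is non-negative on the whole real line (`pwCert32_FH_nonneg`):

  `0 ≤ Re ψ(1/4 + iy/2) − log π + s + Ê_χ(y) − Σ_n a_n cos(y log n) + Hsos(y)`  for all real `y`,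

where `Hsos` has all its frequencies outside the window `[-2b, 2b]` (`SOSData.Hsos_frequencies`).
-/

-- `Summit.RiemannHypothesis.RiemannHypothesis.…` repeats a namespace component by design (D-0017 layout).
set_option linter.dupNamespace false

noncomputable section

namespace Summit.RiemannHypothesis.RiemannHypothesis.Theorems.SignCone

open Literature.Analysis.ValidatedNumerics.Numerics Literature.NumberTheory.LFunctions

/-- All anchored grid groups of the certificate. [folklore] -/
def pwCert32Groups : List (ℚ × List ℚ) := pwCert32G0 ++ (pwCert32G1 ++ (pwCert32G2 ++ (pwCert32G3 ++ (pwCert32G4 ++ (pwCert32G5 ++ (pwCert32G6 ++ (pwCert32G7 ++ (pwCert32G8 ++ (pwCert32G9 ++ (pwCert32G10 ++ (pwCert32G11 ++ (pwCert32G12 ++ (pwCert32G13 ++ (pwCert32G14 ++ (pwCert32G15 ++ (pwCert32G16 ++ (pwCert32G17 ++ (pwCert32G18 ++ (pwCert32G19 ++ (pwCert32G20 ++ (pwCert32G21 ++ (pwCert32G22 ++ (pwCert32G23 ++ (pwCert32G24 ++ (pwCert32G25 ++ (pwCert32G26 ++ (pwCert32G27 ++ pwCert32G28)))))))))))))))))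))))))))))

set_option maxHeartbeats 0 in
/-- The point lists chain from `0` to `Y₀ = 425`. [folklore] -/
theorem pwCert32_chain : PWData.chainOK (pwCert32Groups.map Prod.snd) 0 425 = true := by
  decide +kernel

/-- Every group passes the corrected fast checker. [folklore] -/
theorem pwCert32_groups_all : ∀ g ∈ pwCert32Groups, pwCert32.checkAGrid₂Z pwCert32cs pwCert32logs pwCert32fac pwCert32hl g = true :=
  List.forall_mem_append.2 ⟨pwCert32_groups0, List.forall_mem_append.2 ⟨pwCert32_groups1, List.forall_mem_append.2 ⟨pwCert32_groups2, List.forall_mem_append.2 ⟨pwCert32_groups3, List.forall_mem_append.2 ⟨pwCert32_groups4, List.forall_mem_append.2 ⟨pwCert32_groups5, List.forall_mem_append.2 ⟨pwCert32_groups6, List.forall_mem_append.2 ⟨pwCert32_groups7, List.forall_mem_append.2 ⟨pwCert32_groups8, List.forall_mem_append.2 ⟨pwCert32_groups9, List.forall_mem_append.2 ⟨pwCert32_groups10, List.forall_mem_append.2 ⟨pwCert32_groups11, List.forall_mem_append.2 ⟨pwCert32_groups12, List.forall_mem_append.2 ⟨pwCert32_groups13, List.forall_mem_append.2 ⟨pwCert32_groups14,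 List.forall_mem_append.2 ⟨pwCert32_groups15, List.forall_mem_append.2 ⟨pwCert32_groups16, List.forall_mem_append.2 ⟨pwCert32_groups17, List.forall_mem_append.2 ⟨pwCert32_groups18, List.forall_mem_append.2 ⟨pwCert32_groups19, List.forall_mem_append.2 ⟨pwCert32_groups20, List.forall_mem_append.2 ⟨pwCert32_groups21, List.forall_mem_append.2 ⟨pwCert32_groups22, List.forall_mem_append.2 ⟨pwCert32_groups23, List.forall_mem_append.2 ⟨pwCert32_groups24, List.forall_mem_append.2 ⟨pwCert32_groups25, List.forall_mem_append.2 ⟨pwCert32_groups26, List.forall_mem_append.2 ⟨pwCert32_groups27, pwCert32_groups28⟩⟩⟩⟩⟩⟩⟩⟩⟩⟩⟩⟩⟩⟩⟩⟩⟩⟩⟩⟩⟩⟩⟩⟩⟩⟩⟩⟩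

/-- **The corrected density of `pwCert32` is non-negative**: `∀ y, 0 ≤ pwCert32.F y + pwCert32sos.Hsos y`. [folklore] -/
theorem pwCert32_FH_nonneg (y : ℝ) : 0 ≤ pwCert32.F y + pwCert32sos.Hsos y :=
  PWData.F_add_Hsos_nonneg_of_checksZ pwCert32_checkScalars pwCert32_tables pwCert32_hterms pwCert32_tailH
    pwCert32fac pwCert32Groups pwCert32_chain pwCert32_groups_all y

end Summit.RiemannHypothesis.RiemannHypothesis.Theorems.SignCone

end
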